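import Mathlib
import Literature.Computability.Complexity.SignDegreeXor

/-!
# The pairwise-independent distribution on `P⋆⁻¹(s)` and the rigidity of the balanced point
(cell `pnp-ideate`, ROUND-20 §3: the degree-2 ceiling N6)

FRONTIER range-avoidance ladder, rung F-N3 (`P⋆ = x_a ⊕ x_b ⊕ x_c·x_d` at linear stretch) — restricted-model
no-go bookkeeping; nothing here bears on `P` vs `NP`.

Every isolation / refutation certificate for pure `P⋆` maps that is LINEAR IN PAIR STATISTICS of the slots
(the flip inequalities K1/A/B of `PstarIsolation*`, degree-2 Sherali–Adams/SOS, signed-adjacency spectral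
refutations) can only exclude a range point `y` near the base point if the predicate contexts `P⋆(u) = s` carry NO
probability distribution whose four slot values are pairwise independent with the prescribed slot biases: such a
distribution is a feasible point of the degree-2 relaxation with zero flipped outputs.  This file records the
two facts behind ROUND-20's "degree-2 ceiling":

* `pairwiseIndep_lp`: for every context `s` the distribution `lp r s` — XOR slot `0` uniform, AND slots `2,3`
  i.i.d. with bias `r` where `2r² = 1`, XOR slot `1` determined by `u₁ = u₀ ⊕ u₂u₃ ⊕ s` — is supported on
  `P⋆⁻¹(s)` (`lp_support`), is a probability distribution (`lp_nonneg`, `lp_total`; `r = √2/2` qualifies,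
  `lp_hyp_sqrt`), has biases `(½, ½, r, r)` (`pr1_lp_*`) and PAIRWISE INDEPENDENT slots.  Its biases on XOR and
  AND slots differ (`½ ≠ r`): it lives on TYPED / XOR–AND-unbalanced instances, where it is the exact blind spot
  `(p, q) = (½, 1 - 1/√2)` of all four linear flip certificates and is realised by planted instances (memo §3, §6).
* `bias_eq_one_of_tied`: conversely, a pairwise-independent distribution on `P⋆⁻¹(1)` whose four biases are TIED
  to a common value `p` has `p = 1` (`2p(1-p) = P(u₀ ≠ u₁) = P(u₂u₃ = 0) = 1 - p²` forces `(p-1)² = 0`), hence is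
  the point mass at `1111` (`eq_pointMass_of_tied`): on BALANCED (untyped, slot-regular) instances the only
  degree-2-feasible point with the all-ones context everywhere is the planted point itself — which is why the
  balanced-diagonal isolation theorem `PstarIsolationBound.isolationTheorem` (M19) exists and why balance is the
  ceiling of the whole degree-2 family.  [posed and proved in the cell, ROUND-20 seed §3]
-/

set_option linter.dupNamespace false

open Literature.Computability.Complexity

namespace Summit.PneNP.PneNP.Theorems.PstarPairwise

/-! ### Sums over `{0,1}⁴`, one- and two-slot marginals -/

/-- `{0,1}⁴` as iterated Booleans. -/
def tupEquiv : Bool × Bool × Bool × Bool ≃ (Fin 4 → Bool) where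
  toFun p := ![p.1, p.2.1, p.2.2.1, p.2.2.2]
  invFun u := (u 0, u 1, u 2, u 3)
  left_inv p := rfl
  right_inv u := by
    funext i
    fin_cases i <;> rfl

/-- A sum over `{0,1}⁴` is a fourfold Boolean sum. -/
theorem sum_fin4 (g : (Fin 4 → Bool) → ℝ) : ∑ u, g u = ∑ a, ∑ b, ∑ c, ∑ d, g ![a, b, c, d] := by
  rw [← Fintype.sum_equiv tupEquiv (fun p => g (tupEquiv p)) g (fun _ => rfl)]
  simp only [Fintype.sum_prod_type]
  rfl

/-- One-slot marginal of a weight `w` on `{0,1}⁴`: the mass of `{u | u i = α}`. -/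
def pr1 (w : (Fin 4 → Bool) → ℝ) (i : Fin 4) (α : Bool) : ℝ := ∑ u, if u i = α then w u else 0

/-- Two-slot marginal of a weight `w` on `{0,1}⁴`: the mass of `{u | u i = α ∧ u j = β}`. -/
def pr2 (w : (Fin 4 → Bool) → ℝ) (i j : Fin 4) (α β : Bool) : ℝ :=
  ∑ u, if u i = α ∧ u j = β then w u else 0

/-- Pairwise independence of the four slots under the weight `w` (a product rule for every pair of distinct
slots and every pair of values). -/
def PairwiseIndep (w : (Fin 4 → Bool) → ℝ) : Prop :=
  ∀ i j : Fin 4, i ≠ j → ∀ α β : Bool, pr2 w i j α β = pr1 w i α * pr1 w j β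

/-! ### The LP-point distribution `lp r s` -/

/-- Weight of an AND-slot value under bias `r`: `true ↦ r`, `false ↦ 1 - r`. -/
noncomputable def rho (r : ℝ) (b : Bool) : ℝ := if b then r else 1 - r

/-- **The LP-point distribution on `P⋆⁻¹(s)`**: `u₀` uniform, `u₂, u₃` i.i.d. with bias `r`, `u₁ := u₀ ⊕ u₂u₃ ⊕ s`;
i.e. weight `½·ρ(u₂)ρ(u₃)` on the patterns with `P⋆(u) = s` and `0` elsewhere. -/
noncomputable def lp (r : ℝ) (s : Bool) (u : Fin 4 → Bool) : ℝ :=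
  if xorAndPred u = s then 1 / 2 * (rho r (u 2) * rho r (u 3)) else 0

/-- `lp r s` is supported on the context `P⋆(u) = s`. -/
theorem lp_support (r : ℝ) (s : Bool) (u : Fin 4 → Bool) (h : lp r s u ≠ 0) : xorAndPred u = s := by
  by_contra hne
  exact h (by simp [lp, hne])

/-- `lp r s` is nonnegative for `0 ≤ r ≤ 1`. -/
theorem lp_nonneg {r : ℝ} (h0 : 0 ≤ r) (h1 : r ≤ 1) (s : Bool) (u : Fin 4 → Bool) : 0 ≤ lp r s u := by
  have hρ : ∀ b, 0 ≤ rho r b := fun b => by cases b <;> simp [rho] <;> linarith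
  unfold lp
  split_ifs
  · exact mul_nonneg (by norm_num) (mul_nonneg (hρ _) (hρ _))
  · exact le_rfl

/-- The weight of a concrete pattern. -/
theorem lp_cons (r : ℝ) (s a b c d : Bool) :
    lp r s ![a, b, c, d] = if xor (xor a b) (c && d) = s then 1 / 2 * (rho r c * rho r d) else 0 := rfl

/-- `lp r s` has total mass `1` (for every `r`). -/
theorem lp_total (r : ℝ) (s : Bool) : ∑ u, lp r s u = 1 := by
  cases s <;> simp [sum_fin4, lp_cons, rho] <;> ring

/-- XOR slot `0` has bias `½`. -/
theorem pr1_lp_zero (r : ℝ) (s : Bool) : pr1 (lp r s) 0 true = 1 / 2 := by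
  cases s <;> simp [pr1, sum_fin4, lp_cons, rho] <;> ring

/-- XOR slot `1` has bias `½`. -/
theorem pr1_lp_one (r : ℝ) (s : Bool) : pr1 (lp r s) 1 true = 1 / 2 := by
  cases s <;> simp [pr1, sum_fin4, lp_cons, rho] <;> ring

/-- AND slot `2` has bias `r`. -/
theorem pr1_lp_two (r : ℝ) (s : Bool) : pr1 (lp r s) 2 true = r := by
  cases s <;> simp [pr1, sum_fin4, lp_cons, rho] <;> ring

/-- AND slot `3` has bias `r`. -/
theorem pr1_lp_three (r : ℝ) (s : Bool) : pr1 (lp r s) 3 true = r := by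
  cases s <;> simp [pr1, sum_fin4, lp_cons, rho] <;> ring

/-- Symmetry of the two-slot marginal. -/
theorem pr2_comm (w : (Fin 4 → Bool) → ℝ) (i j : Fin 4) (α β : Bool) : pr2 w i j α β = pr2 w j i β α := by
  unfold pr2
  refine Finset.sum_congr rfl fun u _ => ?_
  simp only [and_comm]

/-- Product rule for the slot pair `(0,1)` (the two XOR slots; this is the pair that uses `2r² = 1`). -/
theorem indep_lp_01 {r : ℝ} (hr : 2 * r ^ 2 = 1) (s α β : Bool) :
    pr2 (lp r s) 0 1 α β = pr1 (lp r s) 0 α * pr1 (lp r s) 1 β := by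
  cases α <;> cases β <;> cases s <;> simp [pr1, pr2, sum_fin4, lp_cons, rho] <;> nlinarith [hr]

/-- Product rule for the slot pair `(0,2)`. -/
theorem indep_lp_02 (r : ℝ) (s α β : Bool) :
    pr2 (lp r s) 0 2 α β = pr1 (lp r s) 0 α * pr1 (lp r s) 2 β := by
  cases α <;> cases β <;> cases s <;> simp [pr1, pr2, sum_fin4, lp_cons, rho] <;> ring

/-- Product rule for the slot pair `(0,3)`. -/
theorem indep_lp_03 (r : ℝ) (s α β : Bool) :
    pr2 (lp r s) 0 3 α β = pr1 (lp r s) 0 α * pr1 (lp r s) 3 β := by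
  cases α <;> cases β <;> cases s <;> simp [pr1, pr2, sum_fin4, lp_cons, rho] <;> ring

/-- Product rule for the slot pair `(1,2)`. -/
theorem indep_lp_12 (r : ℝ) (s α β : Bool) :
    pr2 (lp r s) 1 2 α β = pr1 (lp r s) 1 α * pr1 (lp r s) 2 β := by
  cases α <;> cases β <;> cases s <;> simp [pr1, pr2, sum_fin4, lp_cons, rho] <;> ring

/-- Product rule for the slot pair `(1,3)`. -/
theorem indep_lp_13 (r : ℝ) (s α β : Bool) :
    pr2 (lp r s) 1 3 α β = pr1 (lp r s) 1 α * pr1 (lp r s) 3 β := by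
  cases α <;> cases β <;> cases s <;> simp [pr1, pr2, sum_fin4, lp_cons, rho] <;> ring

/-- Product rule for the slot pair `(2,3)` (the two AND slots, independent by construction). -/
theorem indep_lp_23 (r : ℝ) (s α β : Bool) :
    pr2 (lp r s) 2 3 α β = pr1 (lp r s) 2 α * pr1 (lp r s) 3 β := by
  cases α <;> cases β <;> cases s <;> simp [pr1, pr2, sum_fin4, lp_cons, rho] <;> ring

/-- **Pairwise independence at the LP point**: if `2r² = 1` then the four slots are pairwise independent under
`lp r s`, for both contexts `s`.  (Only the pair of XOR slots uses `2r² = 1`: `P(u₀ = 1, u₁ = 1) = ½·P(u₂u₃ = s ⊕ 1)`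
must equal `¼`.) -/
theorem pairwiseIndep_lp {r : ℝ} (hr : 2 * r ^ 2 = 1) (s : Bool) : PairwiseIndep (lp r s) := by
  intro i j hij α β
  fin_cases i <;> fin_cases j
  · exact absurd rfl hij
  · exact indep_lp_01 hr s α β
  · exact indep_lp_02 r s α β
  · exact indep_lp_03 r s α β
  · rw [pr2_comm, mul_comm]; exact indep_lp_01 hr s β α
  · exact absurd rfl hij
  · exact indep_lp_12 r s α β
  · exact indep_lp_13 r s α β
  · rw [pr2_comm, mul_comm]; exact indep_lp_02 r s β α
  · rw [pr2_comm, mul_comm]; exact indep_lp_12 r s β α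
  · exact absurd rfl hij
  · exact indep_lp_23 r s α β
  · rw [pr2_comm, mul_comm]; exact indep_lp_03 r s β α
  · rw [pr2_comm, mul_comm]; exact indep_lp_13 r s β α
  · rw [pr2_comm, mul_comm]; exact indep_lp_23 r s β α
  · exact absurd rfl hij

/-- The hypotheses are met by `r = √2/2 = 1/√2`: `2r² = 1` and `0 ≤ r ≤ 1`. -/
theorem lp_hyp_sqrt : 2 * (Real.sqrt 2 / 2) ^ 2 = 1 ∧ 0 ≤ Real.sqrt 2 / 2 ∧ Real.sqrt 2 / 2 ≤ 1 := by
  have h2 : Real.sqrt 2 ^ 2 = 2 := Real.sq_sqrt (by norm_num)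
  have h0 : 0 ≤ Real.sqrt 2 := Real.sqrt_nonneg 2
  refine ⟨by nlinarith [h2], by positivity, ?_⟩
  nlinarith [h2, h0]

/-! ### Rigidity of the tied (balanced) point -/

/-- **Tied biases force the point mass.**  If a weight `w` of total mass `1` supported on `P⋆⁻¹(1)` has pairwise
independent slots with a COMMON bias `p` on all four slots, then `p = 1`.  (No sign condition on `w` is needed:
`P(u₀ ≠ u₁) = 2(p - p²)` by independence of the XOR slots, `= P(u₂u₃ = 0) = 1 - p²` by the support and independence
of the AND slots, so `(p - 1)² = 0`.) -/
theorem bias_eq_one_of_tied (w : (Fin 4 → Bool) → ℝ) (p : ℝ) (htot : ∑ u, w u = 1)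
    (hsupp : ∀ u, w u ≠ 0 → xorAndPred u = true) (hind : PairwiseIndep w)
    (hbias : ∀ i : Fin 4, pr1 w i true = p) : p = 1 := by
  have z1 : w ![false, false, false, false] = 0 := by
    by_contra h; simpa [xorAndPred_apply] using hsupp _ h
  have z2 : w ![false, false, false, true] = 0 := by
    by_contra h; simpa [xorAndPred_apply] using hsupp _ h
  have z3 : w ![false, false, true, false] = 0 := by
    by_contra h; simpa [xorAndPred_apply] using hsupp _ h
  have z7 : w ![true, false, true, true] = 0 := by
    by_contra h; simpa [xorAndPred_apply] using hsupp _ h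
  have z8 : w ![false, true, true, true] = 0 := by
    by_contra h; simpa [xorAndPred_apply] using hsupp _ h
  have z4 : w ![true, true, false, false] = 0 := by
    by_contra h; simpa [xorAndPred_apply] using hsupp _ h
  have z5 : w ![true, true, false, true] = 0 := by
    by_contra h; simpa [xorAndPred_apply] using hsupp _ h
  have z6 : w ![true, true, true, false] = 0 := by
    by_contra h; simpa [xorAndPred_apply] using hsupp _ h
  have h01 := hind 0 1 (by decide) true true
  have h23 := hind 2 3 (by decide) true true
  rw [hbias 0, hbias 1] at h01
  rw [hbias 2, hbias 3] at h23
  have b0 := hbias 0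
  have b1 := hbias 1
  simp only [pr1, pr2, sum_fin4, Fintype.sum_bool, Matrix.cons_val_zero, Matrix.cons_val_one, Matrix.head_cons,
    Matrix.cons_val_two, Matrix.cons_val_three, Matrix.tail_cons, and_true, and_false,
    Bool.false_eq_true, ite_true, ite_false, add_zero, zero_add, z1, z2, z3, z4, z5, z6, z7, z8] at h01 h23 b0 b1
  simp only [sum_fin4, Fintype.sum_bool, z1, z2, z3, z4, z5, z6, z7, z8, add_zero, zero_add] at htot
  have key : (p - 1) ^ 2 = 0 := by linear_combination b0 + b1 - htot + h23 - 2 * h01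
  have h := (pow_eq_zero_iff two_ne_zero).1 key
  linarith

/-- **… hence the point mass at `1111`.**  Under the hypotheses of `bias_eq_one_of_tied` plus nonnegativity, `w` is
the Dirac mass at the all-true pattern: the balanced degree-2-feasible point with the all-ones context is the
planted point itself. -/
theorem eq_pointMass_of_tied (w : (Fin 4 → Bool) → ℝ) (p : ℝ) (hnn : ∀ u, 0 ≤ w u) (htot : ∑ u, w u = 1)
    (hsupp : ∀ u, w u ≠ 0 → xorAndPred u = true) (hind : PairwiseIndep w)
    (hbias : ∀ i : Fin 4, pr1 w i true = p) :
    w (fun _ => true) = 1 ∧ ∀ u, u ≠ (fun _ => true) → w u = 0 := by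
  have hp : p = 1 := bias_eq_one_of_tied w p htot hsupp hind hbias
  have z1 : w ![false, false, false, false] = 0 := by
    by_contra h; simpa [xorAndPred_apply] using hsupp _ h
  have z2 : w ![false, false, false, true] = 0 := by
    by_contra h; simpa [xorAndPred_apply] using hsupp _ h
  have z3 : w ![false, false, true, false] = 0 := by
    by_contra h; simpa [xorAndPred_apply] using hsupp _ h
  have z7 : w ![true, false, true, true] = 0 := by
    by_contra h; simpa [xorAndPred_apply] using hsupp _ h
  have z8 : w ![false, true, true, true] = 0 := by
    by_contra h; simpa [xorAndPred_apply] using hsupp _ h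
  have z4 : w ![true, true, false, false] = 0 := by
    by_contra h; simpa [xorAndPred_apply] using hsupp _ h
  have z5 : w ![true, true, false, true] = 0 := by
    by_contra h; simpa [xorAndPred_apply] using hsupp _ h
  have z6 : w ![true, true, true, false] = 0 := by
    by_contra h; simpa [xorAndPred_apply] using hsupp _ h
  have b0 := hbias 0
  have b1 := hbias 1
  simp only [pr1, sum_fin4, Fintype.sum_bool, Matrix.cons_val_zero, Matrix.cons_val_one,
    Bool.false_eq_true, ite_true, ite_false, add_zero, zero_add, z1, z2, z3, z4, z5, z6, z7, z8, hp] at b0 b1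
  simp only [sum_fin4, Fintype.sum_bool, z1, z2, z3, z4, z5, z6, z7, z8, add_zero, zero_add] at htot
  have nA := hnn ![true, false, false, false]
  have nB := hnn ![true, false, false, true]
  have nC := hnn ![true, false, true, false]
  have nD := hnn ![false, true, false, false]
  have nE := hnn ![false, true, false, true]
  have nF := hnn ![false, true, true, false]
  have nG := hnn ![false, false, true, true]
  have hA : w ![true, false, false, false] = 0 := by linarith
  have hB : w ![true, false, false, true] = 0 := by linarith
  have hC : w ![true, false, true, false] = 0 := by linarith
  have hD : w ![false, true, false, false] = 0 := by linarith
  have hE : w ![false, true, false, true] = 0 := by linarith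
  have hF : w ![false, true, true, false] = 0 := by linarith
  have hG : w ![false, false, true, true] = 0 := by linarith
  have hH : w ![true, true, true, true] = 1 := by linarith
  have e1 : (![true, true, true, true] : Fin 4 → Bool) = fun _ => true := by
    funext i
    fin_cases i <;> rfl
  refine ⟨by rw [← e1]; exact hH, fun u hu => ?_⟩
  obtain ⟨a, b, c, d, rfl⟩ : ∃ a b c d : Bool, u = ![a, b, c, d] :=
    ⟨u 0, u 1, u 2, u 3, by funext i; fin_cases i <;> rfl⟩
  cases a <;> cases b <;> cases c <;> cases d <;> first | assumption | exact absurd e1 hu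

end Summit.PneNP.PneNP.Theorems.PstarPairwise
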